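import Summits.BirchSwinnertonDyer.BirchSwinnertonDyer.Theorems.RamifiedSevenEllipticUnitsEndRankTwoSpan
import Summits.BirchSwinnertonDyer.BirchSwinnertonDyer.Theorems.RamifiedSevenEllipticUnitsRelaxedEqCompactOfBottomIndex
import Summits.BirchSwinnertonDyer.BirchSwinnertonDyer.Theorems.RamifiedSevenEllipticUnitsKummerFrameChart
import Summits.BirchSwinnertonDyer.BirchSwinnertonDyer.Theorems.RamifiedSevenEllipticUnitsKummerPadicIndex
import HarnessLib

set_option linter.dupNamespace false
set_option autoImplicit false

/-!
# Route `RamifiedSevenEllipticUnits` (rung K7r), value crux `EllipticUnitValueSevenOfGZK`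
# (stmt-BirchSwinnertonDyer-19945), line `rubin-formula-zp`, stub S_sat — **`S_{p,rel}(E/K) = S_p(E/K)`
# FROM THE BOTTOM INDEX EXPONENT ALONE (the RANK ROUTE: no `z(𝟙) ∈ S_p` binder, no explicit reciprocity
# law, no global duality, no GZK)** (PROVED; `--supports 19945`)

Cell `bsd-cm`, seat `bsd-cm-k7r-c2` g5 (CLAIM «F6» on STATUS 2026-08-27). HONEST FRAMING: subgroup
algebra over landed lemmas; nothing about any curve's arithmetic is asserted; BSD is not proved; no named
fact is minted; no definition is introduced; `sorry`-free.

## Statement and argument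

Bottom layer `H = κ.layerSubgroup 0 = Γ_K` of a `ℤ_p`-tower over a number field `K`, `E = V` elliptic,
`S_rel = relaxedCompactSelmerOver H p P`, `S_p = compactSelmerOver H p`, a family `z` with
(hc) `[S_rel : tors ⊔ 𝒪_𝔭 · z] = p^c` (`padicEndSpan`; the shape of `EllipticUnitClassData.HasBottomIndexExpZp`),
and two families `κ₁, κ₂ ∈ S_p` which are `ℤ_p`-INDEPENDENT (`α · κ₁ + β · κ₂ = 0 ⇒ α = β = 0`). THEN
`S_rel = S_p` (`relaxed_eq_compact_of_rank`):
(1) by `EndRankTwo` there is `ψ ∈ End_K(E)` with every `w ∈ 𝒪_𝔭 · z` satisfying `N w = α z + β ψz`, so by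
(hc) every `x ∈ S_rel` has `N • x = α · z + β · ψz` with `N ≠ 0` (torsion is killed by a further multiple);
(2) applied to `κ₁, κ₂`: `Nᵢ κᵢ = αᵢ z + βᵢ ψz`; Cramer: `δ · z = β₂(N₁κ₁) − β₁(N₂κ₂) ∈ S_p` and
`δ · ψz = α₁(N₂κ₂) − α₂(N₁κ₁) ∈ S_p` with `δ = α₁β₂ − α₂β₁`; (3) `δ ≠ 0`, for otherwise independence forces
`αᵢ = βᵢ = 0` and then `N₁ κ₁ = 0`; (4) `δ = u p^a` (`PadicInt.unitCoeff_spec`), so `(p^a N) • x ∈ S_p` for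
every `x ∈ S_rel`, and the saturation of `S_p` in `S_rel` (`RelaxedSelmerSaturation`, p466833) gives
`x ∈ S_p`. AT AN O11 FRAME (`relaxed_eq_compact_of_frame`): `κ₁ = κ(P_K)`, `κ₂ = κ(T₂)` are the Kummer
families of the generator of `W(ℚ)` and of the twisted generator of `W'(ℚ)` (k7r-c3's frame chart
`KummerCore.exists_frameChart`, values (V1)(V2)); their independence is read in the chart after
localisation (`KummerCore.localKummer_torsionFree_and_chart_detects`): `(α λP, β λ'P') = 0`, `λP, λ'P' ≠ 0`.
CONSEQUENCE: in the ALT form of S_sat the half «relaxed = compact» holds for EVERY datum with a bottom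
index exponent at an analytic-rank-one frame — the binder `hvan`/`z(𝟙) ∈ S_p` of the earlier route
(p472558 `…_of_hvan`; not dischargeable, STATUS 2026-08-27 «erl threshold») is not needed, and S_sat
reduces to (S_sat-MW) `S_p ≤ E(K) ⊗ ℤ_p` (`T_pШ(E/K) = 0`: p475098 + k8i-c2 p474926 + GZK).

## Results (namespace `…Theorems.RamifiedSevenEllipticUnits.RelaxedEqCompactRank`)

* `exists_zsmul_eq_pair_of_mem_relaxed` — step (1); `relaxed_eq_compact_of_rank` — steps (2)–(4);
* `exists_independent_kummerFamilies_of_frame` — the two independent Kummer families at an O11 frame;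
* `relaxed_eq_compact_of_frame`, `relaxed_le_mordellWeilKummerSpan_of_frame` — at an O11 frame:
  (hc) for some `z` ⟹ `S_rel = S_p`, and `S_p ≤ E(K) ⊗ ℤ_p ⟹ S_rel ≤ E(K) ⊗ ℤ_p`;
* `relaxed_le_mordellWeilKummerSpan_of_hasBottomIndexExpZp_of_frame` — the datum form
  (`D.HasBottomIndexExpZp c → (S_p ≤ MW-span) → S_rel ≤ MW-span`), superseding p472558's `…_of_hvan`.

References: J. H. Silverman, *AEC* (2009) Cor. III.9.4, VIII.§2, Ex. 10.16 [SilvermanAEC2009]; [BKNO]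
arXiv:2608.06879v1 §3.1.2, §3.3.1, Prop. 3.7 (3) (`𝒮_rel` has rank one) [BurungaleKobayashiNakamuraOta2026];
B. Perrin-Riou, Bull. SMF 115 (1987) §0 [PerrinRiou1987BSMF]; cell texts `Lines/rubin-formula-zp.md`
(«GZK-free algebraic route»), MEMO-k7r-c4-g5-CARRIER §5, STATUS D117.
-/

noncomputable section

open scoped Classical

open WeierstrassCurve NumberField IsDedekindDomain Field
  Literature.NumberTheory.EllipticCurves
  Literature.NumberTheory.GaloisRepresentations
  Literature.NumberTheory.EllipticCurves.BurungaleKobayashiNakamuraOta2026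

universe u

namespace Summit.BirchSwinnertonDyer.BirchSwinnertonDyer.Theorems.RamifiedSevenEllipticUnits

namespace RelaxedEqCompactRank

/-! ## Part 1. Scalar plumbing for `padicPi` -/

section Scalars

variable {K : Type u} [Field K] (V : WeierstrassCurve K) (p : ℕ) [Fact p.Prime]
  (H : Subgroup (Field.absoluteGaloisGroup K))

/-- `(c − c') · y = c · y − c' · y`. [cite: PerrinRiou1987BSMF, §0 p. 401 (the `ℤ_p`-module `S_p(L)`)] -/
theorem padicPi_sub_left (c c' : ℤ_[p]) (y : V.torsionH1Pi p H) :
    V.padicPi p H (c - c') y = V.padicPi p H c y - V.padicPi p H c' y := by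
  rw [sub_eq_add_neg, KummerCore.padicPi_add_left_of_levelTorsion (EndRankTwo.levelTorsion V p H y),
    KummerCore.padicPi_neg_left_of_levelTorsion (EndRankTwo.levelTorsion V p H y), ← sub_eq_add_neg]

/-- `c · (c' · y) = c' · (c · y)` (`ℤ_p` is commutative). [cite: PerrinRiou1987BSMF, §0 p. 401 (the `ℤ_p`-module `S_p(L)`)] -/
theorem padicPi_comm (c c' : ℤ_[p]) (y : V.torsionH1Pi p H) :
    V.padicPi p H c (V.padicPi p H c' y) = V.padicPi p H c' (V.padicPi p H c y) := by
  rw [padicPi_padicPi, padicPi_padicPi, mul_comm]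

/-- Cramer's combination: `β₂ · (α₁ z + β₁ w) − β₁ · (α₂ z + β₂ w) = (α₁β₂ − α₂β₁) · z`.
[cite: PerrinRiou1987BSMF, §0 p. 401 (the `ℤ_p`-module `S_p(L)`; linear algebra)] -/
theorem cramer_fst (α₁ β₁ α₂ β₂ : ℤ_[p]) (z w : V.torsionH1Pi p H) :
    V.padicPi p H β₂ (V.padicPi p H α₁ z + V.padicPi p H β₁ w) -
        V.padicPi p H β₁ (V.padicPi p H α₂ z + V.padicPi p H β₂ w) =
      V.padicPi p H (α₁ * β₂ - α₂ * β₁) z := by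
  rw [map_add, map_add, padicPi_padicPi, padicPi_padicPi, padicPi_padicPi, padicPi_padicPi,
    padicPi_sub_left, mul_comm β₂ α₁, mul_comm β₁ α₂, mul_comm β₁ β₂]
  abel

/-- Cramer's combination: `α₁ · (α₂ z + β₂ w) − α₂ · (α₁ z + β₁ w) = (α₁β₂ − α₂β₁) · w`.
[cite: PerrinRiou1987BSMF, §0 p. 401 (the `ℤ_p`-module `S_p(L)`; linear algebra)] -/
theorem cramer_snd (α₁ β₁ α₂ β₂ : ℤ_[p]) (z w : V.torsionH1Pi p H) :
    V.padicPi p H α₁ (V.padicPi p H α₂ z + V.padicPi p H β₂ w) -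
        V.padicPi p H α₂ (V.padicPi p H α₁ z + V.padicPi p H β₁ w) =
      V.padicPi p H (α₁ * β₂ - α₂ * β₁) w := by
  rw [map_add, map_add, padicPi_padicPi, padicPi_padicPi, padicPi_padicPi, padicPi_padicPi,
    padicPi_sub_left, mul_comm α₂ α₁]
  abel

end Scalars

/-! ## Part 2. The rank route at the bottom layer of a `ℤ_p`-tower over a number field -/

section Bottom

variable {K : Type u} [Field K] [NumberField K] (V : WeierstrassCurve K) [V.IsElliptic] (p : ℕ)
  [Fact p.Prime] (κ : ZpExtension K p)

omit [V.IsElliptic] in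
/-- **Step (1): every `x ∈ S_{p,rel}` has `N • x = α · z + β · ψz` with `N ≠ 0`**, given
`[S_rel : tors ⊔ 𝒪_𝔭 · z] = p^c` and an endomorphism `ψ` through which `End_K(E)` is commensurable with
`ℤ + ℤψ` (`EndRankTwo.exists_generator_endRing`): `p^c • x = t + w` with `t` torsion and `w ∈ 𝒪_𝔭 · z`
(`AddSubgroup.nsmul_relIndex_mem`), `N_w • w = α z + β ψz` (`EndRankTwo.exists_zsmul_eq_pair_of_mem_padicEndSpan`),
and the order of `t` kills `t`. [cite: BurungaleKobayashiNakamuraOta2026, §3.3.1 and Prop. 3.7 (3) (arXiv:2608.06879 pp. 19–20) (`𝒮_rel` of rank one; shape only)] -/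
theorem exists_zsmul_eq_pair_of_mem_relaxed (P : Set (HeightOneSpectrum (𝓞 K)))
    {ψ : AddMonoid.End V.geomPoints} (hψ : ψ ∈ V.endRing)
    (hall : ∀ c ∈ V.endRing, ∃ N a b : ℤ, N ≠ 0 ∧
      (N : AddMonoid.End V.geomPoints) * c =
        (a : AddMonoid.End V.geomPoints) + (b : AddMonoid.End V.geomPoints) * ψ)
    {z : V.torsionH1Pi p (κ.layerSubgroup 0)} {c : ℕ}
    (hc : (AddCommGroup.torsion (V.torsionH1Pi p (κ.layerSubgroup 0)) ⊔
        V.padicEndSpan p (κ.layerSubgroup 0) z).relIndex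
      (V.relaxedCompactSelmerOver (κ.layerSubgroup 0) p P) = p ^ c)
    {x : V.torsionH1Pi p (κ.layerSubgroup 0)}
    (hx : x ∈ V.relaxedCompactSelmerOver (κ.layerSubgroup 0) p P) :
    ∃ N : ℤ, N ≠ 0 ∧ ∃ α β : ℤ_[p], N • x = V.padicPi p (κ.layerSubgroup 0) α z +
      V.padicPi p (κ.layerSubgroup 0) β (V.endPi hψ p (κ.layerSubgroup 0) z) := by
  have hp : p.Prime := Fact.out
  have hmem := AddSubgroup.nsmul_relIndex_mem
    (AddCommGroup.torsion (V.torsionH1Pi p (κ.layerSubgroup 0)) ⊔ V.padicEndSpan p (κ.layerSubgroup 0) z) hx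
  rw [hc] at hmem
  obtain ⟨t, ht, w, hw, htw⟩ := AddSubgroup.mem_sup.1 hmem
  obtain ⟨n, hn, hnt⟩ := (isOfFinAddOrder_iff_nsmul_eq_zero).1 ((AddCommGroup.mem_torsion t).1 ht)
  obtain ⟨N, hN, α, β, hNw⟩ :=
    EndRankTwo.exists_zsmul_eq_pair_of_mem_padicEndSpan V p (κ.layerSubgroup 0) hψ hall z hw
  have h1 : ((p ^ c : ℕ) : ℤ) • x = t + w := by rw [natCast_zsmul]; exact htw.symm
  have h2 : (n : ℤ) • t = 0 := by rw [natCast_zsmul]; exact hnt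
  refine ⟨N * n * (p ^ c : ℕ), mul_ne_zero (mul_ne_zero hN (Int.natCast_ne_zero.2 hn.ne'))
    (Int.natCast_ne_zero.2 (pow_ne_zero c hp.ne_zero)), (n : ℤ_[p]) * α, (n : ℤ_[p]) * β, ?_⟩
  calc (N * n * (p ^ c : ℕ)) • x = (N * n) • (((p ^ c : ℕ) : ℤ) • x) := mul_zsmul _ _ _
    _ = N • ((n : ℤ) • t) + (n : ℤ) • (N • w) := by
        rw [h1, zsmul_add, mul_zsmul, mul_comm N n, mul_zsmul]
    _ = V.padicPi p (κ.layerSubgroup 0) ((n : ℤ_[p]) * α) z +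
          V.padicPi p (κ.layerSubgroup 0) ((n : ℤ_[p]) * β) (V.endPi hψ p (κ.layerSubgroup 0) z) := by
        rw [h2, zsmul_zero, zero_add, hNw, zsmul_add, EndRankTwo.zsmul_padicPi,
          EndRankTwo.zsmul_padicPi, Int.cast_natCast]

/-- **`S_{p,rel}(E/K) = S_p(E/K)` by the RANK ROUTE.** Hypotheses: `[S_rel : tors ⊔ 𝒪_𝔭 · z] = p^c` for
some family `z` (the shape of `HasBottomIndexExpZp`), and two `ℤ_p`-independent families `κ₁, κ₂ ∈ S_p`.
Steps (2)–(4) of the module docstring: Cramer's rule on `Nᵢ κᵢ = αᵢ z + βᵢ ψz` puts `δ · z`, `δ · ψz` in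
`S_p` with `δ = α₁β₂ − α₂β₁ ≠ 0` (independence), `δ = u · p^a`, hence `(p^a N) • x ∈ S_p` for every
`x ∈ S_rel`, and saturation (`RelaxedSelmerSaturation.mem_compactSelmerOver_of_zsmul_mem`, p466833)
finishes. No analytic input, no duality. [cite: BurungaleKobayashiNakamuraOta2026, §3.1.2, §3.3.1 and Prop. 3.7 (3) (arXiv:2608.06879 pp. 16, 19–20) (shape only)]
[cite: SilvermanAEC2009, Cor. III.9.4] -/
theorem relaxed_eq_compact_of_rank (P : Set (HeightOneSpectrum (𝓞 K)))
    {z : V.torsionH1Pi p (κ.layerSubgroup 0)} {c : ℕ}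
    (hc : (AddCommGroup.torsion (V.torsionH1Pi p (κ.layerSubgroup 0)) ⊔
        V.padicEndSpan p (κ.layerSubgroup 0) z).relIndex
      (V.relaxedCompactSelmerOver (κ.layerSubgroup 0) p P) = p ^ c)
    {κ₁ κ₂ : V.torsionH1Pi p (κ.layerSubgroup 0)}
    (h₁ : κ₁ ∈ V.compactSelmerOver (κ.layerSubgroup 0) p)
    (h₂ : κ₂ ∈ V.compactSelmerOver (κ.layerSubgroup 0) p)
    (hind : ∀ α β : ℤ_[p],
      V.padicPi p (κ.layerSubgroup 0) α κ₁ + V.padicPi p (κ.layerSubgroup 0) β κ₂ = 0 → α = 0 ∧ β = 0) :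
    V.relaxedCompactSelmerOver (κ.layerSubgroup 0) p P = V.compactSelmerOver (κ.layerSubgroup 0) p := by
  have hp : p.Prime := Fact.out
  haveI : CharZero K := inferInstance
  obtain ⟨ψ, hψ, hall⟩ := EndRankTwo.exists_generator_endRing V
  -- step (2): the two families in the span of `z`, `ψz` after a multiple
  obtain ⟨N₁, hN₁, α₁, β₁, e₁⟩ := exists_zsmul_eq_pair_of_mem_relaxed V p κ P hψ hall hc
    (V.compactSelmerOver_le_relaxedCompactSelmerOver _ p P h₁)
  obtain ⟨N₂, hN₂, α₂, β₂, e₂⟩ := exists_zsmul_eq_pair_of_mem_relaxed V p κ P hψ hall hc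
    (V.compactSelmerOver_le_relaxedCompactSelmerOver _ p P h₂)
    -- Cramer
  have hδz : V.padicPi p (κ.layerSubgroup 0) (α₁ * β₂ - α₂ * β₁) z =
      V.padicPi p (κ.layerSubgroup 0) β₂ (N₁ • κ₁) - V.padicPi p (κ.layerSubgroup 0) β₁ (N₂ • κ₂) := by
    rw [e₁, e₂, cramer_fst]
  have hδw : V.padicPi p (κ.layerSubgroup 0) (α₁ * β₂ - α₂ * β₁) (V.endPi hψ p (κ.layerSubgroup 0) z) =
      V.padicPi p (κ.layerSubgroup 0) α₁ (N₂ • κ₂) - V.padicPi p (κ.layerSubgroup 0) α₂ (N₁ • κ₁) := by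
    rw [e₁, e₂, cramer_snd]
  have hSz : V.padicPi p (κ.layerSubgroup 0) (α₁ * β₂ - α₂ * β₁) z ∈ V.compactSelmerOver (κ.layerSubgroup 0) p := by
    rw [hδz]
    exact sub_mem (KummerFamiliesSelmer.padicPi_mem_compactSelmerOver V _ p β₂ (zsmul_mem h₁ N₁))
      (KummerFamiliesSelmer.padicPi_mem_compactSelmerOver V _ p β₁ (zsmul_mem h₂ N₂))
  have hSw : V.padicPi p (κ.layerSubgroup 0) (α₁ * β₂ - α₂ * β₁) (V.endPi hψ p (κ.layerSubgroup 0) z) ∈ V.compactSelmerOver (κ.layerSubgroup 0) p := by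
    rw [hδw]
    exact sub_mem (KummerFamiliesSelmer.padicPi_mem_compactSelmerOver V _ p α₁ (zsmul_mem h₂ N₂))
      (KummerFamiliesSelmer.padicPi_mem_compactSelmerOver V _ p α₂ (zsmul_mem h₁ N₁))
  -- step (3): `δ ≠ 0`
  have hNcast : ∀ {N : ℤ}, N ≠ 0 → (N : ℤ_[p]) ≠ 0 := fun hN ↦ Int.cast_ne_zero.2 hN
  have hδ0 : (α₁ * β₂ - α₂ * β₁) ≠ 0 := by
    intro hδ0
    -- `β₂ N₁ κ₁ − β₁ N₂ κ₂ = (α₁ * β₂ - α₂ * β₁) z = 0`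
    have hz0 : V.padicPi p (κ.layerSubgroup 0) (β₂ * (N₁ : ℤ_[p])) κ₁ + V.padicPi p (κ.layerSubgroup 0) (-(β₁ * (N₂ : ℤ_[p]))) κ₂ = 0 := by
      rw [KummerCore.padicPi_neg_left_of_levelTorsion (EndRankTwo.levelTorsion V p (κ.layerSubgroup 0) κ₂), ← sub_eq_add_neg,
        ← padicPi_padicPi, ← padicPi_padicPi, ← EndRankTwo.zsmul_eq_padicPi,
        ← EndRankTwo.zsmul_eq_padicPi, ← hδz, hδ0, KummerCore.padicPi_zero_left]
    have hw0 : V.padicPi p (κ.layerSubgroup 0) (-(α₂ * (N₁ : ℤ_[p]))) κ₁ + V.padicPi p (κ.layerSubgroup 0) (α₁ * (N₂ : ℤ_[p])) κ₂ = 0 := by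
      rw [KummerCore.padicPi_neg_left_of_levelTorsion (EndRankTwo.levelTorsion V p (κ.layerSubgroup 0) κ₁), add_comm,
        ← sub_eq_add_neg, ← padicPi_padicPi, ← padicPi_padicPi, ← EndRankTwo.zsmul_eq_padicPi,
        ← EndRankTwo.zsmul_eq_padicPi, ← hδw, hδ0, KummerCore.padicPi_zero_left]
    obtain ⟨hb₂, hb₁⟩ := hind _ _ hz0
    obtain ⟨ha₂, ha₁⟩ := hind _ _ hw0
    have hβ₂ : β₂ = 0 := (mul_eq_zero.1 hb₂).resolve_right (hNcast hN₁)
    have hβ₁ : β₁ = 0 := (mul_eq_zero.1 (neg_eq_zero.1 hb₁)).resolve_right (hNcast hN₂)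
    have hα₂ : α₂ = 0 := (mul_eq_zero.1 (neg_eq_zero.1 ha₂)).resolve_right (hNcast hN₁)
    have hα₁ : α₁ = 0 := (mul_eq_zero.1 ha₁).resolve_right (hNcast hN₂)
    -- then `N₁ κ₁ = 0`, contradicting independence
    have hN0 : V.padicPi p (κ.layerSubgroup 0) (N₁ : ℤ_[p]) κ₁ + V.padicPi p (κ.layerSubgroup 0) 0 κ₂ = 0 := by
      rw [KummerCore.padicPi_zero_left, add_zero, ← EndRankTwo.zsmul_eq_padicPi, e₁, hα₁, hβ₁,
        KummerCore.padicPi_zero_left, KummerCore.padicPi_zero_left, add_zero]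
    exact hNcast hN₁ (hind _ _ hN0).1
  -- step (4): `δ = u p^a`; saturation
  obtain ⟨a, u, hu⟩ : ∃ (a : ℕ) (u : ℤ_[p]ˣ), (α₁ * β₂ - α₂ * β₁) = (u : ℤ_[p]) * (p : ℤ_[p]) ^ a :=
    ⟨(α₁ * β₂ - α₂ * β₁).valuation, PadicInt.unitCoeff hδ0, PadicInt.unitCoeff_spec hδ0⟩
  refine le_antisymm (fun x hx ↦ ?_) (V.compactSelmerOver_le_relaxedCompactSelmerOver _ p P)
  obtain ⟨N, hN, α, β, e⟩ := exists_zsmul_eq_pair_of_mem_relaxed V p κ P hψ hall hc hx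
  -- `δ · (N • x) ∈ S_p`
  have hδx : V.padicPi p (κ.layerSubgroup 0) (α₁ * β₂ - α₂ * β₁) (N • x) ∈
      V.compactSelmerOver (κ.layerSubgroup 0) p := by
    rw [e, map_add, padicPi_comm V p (κ.layerSubgroup 0) (α₁ * β₂ - α₂ * β₁) α, padicPi_comm V p (κ.layerSubgroup 0) (α₁ * β₂ - α₂ * β₁) β]
    exact add_mem (KummerFamiliesSelmer.padicPi_mem_compactSelmerOver V _ p α hSz)
      (KummerFamiliesSelmer.padicPi_mem_compactSelmerOver V _ p β hSw)
  -- `p^a · (N • x) ∈ S_p`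
  have hpx : (((p : ℤ) ^ a) * N) • x ∈ V.compactSelmerOver (κ.layerSubgroup 0) p := by
    have h := KummerFamiliesSelmer.padicPi_mem_compactSelmerOver V _ p ((u⁻¹ : ℤ_[p]ˣ) : ℤ_[p]) hδx
    rw [padicPi_padicPi, hu, ← mul_assoc, Units.inv_mul, one_mul] at h
    rw [mul_zsmul, EndRankTwo.zsmul_eq_padicPi V p (κ.layerSubgroup 0) ((p : ℤ) ^ a)]
    push_cast
    exact h
  exact RelaxedSelmerSaturation.mem_compactSelmerOver_of_zsmul_mem V p κ hx
    (mul_ne_zero (pow_ne_zero a (Int.natCast_ne_zero.2 hp.ne_zero)) hN) hpx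

end Bottom

/-! ## Part 3. At an O11 frame: two independent Mordell–Weil Kummer families, hence `S_rel = S_p` -/

section Frame

open Summit.BirchSwinnertonDyer.Rank1Residual

variable (W : WeierstrassCurve ℚ) [W.IsElliptic] [W.IsGloballyMinimal] (p : ℕ) [Fact p.Prime]
  {K : Type} [Field K] [NumberField K] {𝔭 : HeightOneSpectrum (𝓞 K)}
  {W' : WeierstrassCurve ℚ} [W'.IsElliptic] [W'.IsGloballyMinimal] {C : VariableChange ℚ}

/-- **Two `ℤ_p`-INDEPENDENT Mordell–Weil Kummer families at an O11 frame.** Given the frame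
`(K, 𝔭, W', C)` at `p` and non-torsion points `P ∈ W(ℚ)`, `P' ∈ W'(ℚ)`, the Kummer families over
`H = Γ_K` of `P_K` and of the twist `T₂ ∈ W(K)` of `P'` (k7r-c3's frame chart, values (V1)/(V2)) are
`ℤ_p`-independent: a relation `α · κ(P_K) + β · κ(T₂) = 0` localises at `𝔭` to a relation between local
Kummer families, which the chart reads as `(α λP, β λ'P') = (0, 0)` with `λP, λ'P' ≠ 0`
(`KummerCore.exists_frameChart`, `KummerCore.localKummer_torsionFree_and_chart_detects`; the
localisation step as in k7r-c3's (inj), p474339). [cite: SilvermanAEC2009, Exercise 10.16 and Prop. VII.6.3]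
[cite: PerrinRiou1987BSMF, §0 p. 401] -/
theorem exists_independent_kummerFamilies_of_frame (hF : X12.O11.IsFrame W p K 𝔭 W' C)
    {P : W.toAffine.Point} (hP : ¬ IsOfFinAddOrder P) {P' : W'.toAffine.Point}
    (hP' : ¬ IsOfFinAddOrder P') (H : Subgroup (absoluteGaloisGroup K)) (hH : H = ⊤) :
    ∃ m₁ m₂ : (W.baseChange K).fixedGeomPoints H, ∀ α β : ℤ_[p],
      (W.baseChange K).padicPi p H α ((W.baseChange K).kummerFamily p H m₁) +
          (W.baseChange K).padicPi p H β ((W.baseChange K).kummerFamily p H m₂) = 0 →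
        α = 0 ∧ β = 0 := by
  subst hH
  have hp : p.Prime := Fact.out
  obtain ⟨Φ, lam, lam', u, hΦ0, hΦs, hlam0, -, hlam'0, -, -, hV1, hV2, -⟩ :=
    KummerCore.exists_frameChart W p hF
  haveI : NoZeroSMulDivisors ℤ_[p] (ℤ_[p] × ℤ_[p]) := KummerCore.noZeroSMulDivisors_prod_padicInt
  haveI : CharZero (𝔭.adicCompletion K) :=
    charZero_of_injective_algebraMap (algebraMap K (𝔭.adicCompletion K)).injective
  have hE := noPTorsion_adicCompletion_of_isFrame W p hF
  obtain ⟨-, hdet⟩ := KummerCore.localKummer_torsionFree_and_chart_detects (W.baseChange K)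
    (closureEmb (K := K) (𝔭.adicCompletion K)) p Φ hΦ0 hΦs KummerCore.prod_padicInt_separated hE
  set bc : (W.baseChange K).toAffine.Point →+
      ((W.baseChange K).baseChange (𝔭.adicCompletion K)).toAffine.Point :=
    Affine.Point.baseChange (W' := W.baseChange K) K (𝔭.adicCompletion K) with hbc
  -- the two points and the non-vanishing of their chart coordinates
  set PK : (W.baseChange K).toAffine.Point := Affine.Point.baseChange (W' := W) ℚ K P with hPK
  obtain ⟨T₂, hT₂⟩ := hV2 P'
  have hx₁ : lam (W.toPadicPoint p P) ≠ 0 := fun h ↦ hP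
    (((Affine.Point.map_injective (W' := W) (Algebra.ofId ℚ ℚ_[p])).isOfFinAddOrder_iff
      (f := W.toPadicPoint p)).1 ((hlam0 _).1 h))
  have hx₂ : lam' (W'.toPadicPoint p P') ≠ 0 := fun h ↦ hP'
    (((Affine.Point.map_injective (W' := W') (Algebra.ofId ℚ ℚ_[p])).isOfFinAddOrder_iff
      (f := W'.toPadicPoint p)).1 ((hlam'0 _).1 h))
  refine ⟨⟨toGeomPoints (W.baseChange K) PK, KummerCore.toGeomPoints_mem_fixedGeomPoints W ⊤ PK⟩,
    ⟨toGeomPoints (W.baseChange K) T₂, KummerCore.toGeomPoints_mem_fixedGeomPoints W ⊤ T₂⟩,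
    fun α β h ↦ ?_⟩
  -- localise the relation: Kummer families of `K`-points restrict to local Kummer families
  have hlocfam : ∀ R : (W.baseChange K).toAffine.Point,
      (W.baseChange K).localTorsionResPi (closureEmb (K := K) (𝔭.adicCompletion K)) p ⊤
        ((W.baseChange K).kummerFamily p ⊤
          ⟨toGeomPoints (W.baseChange K) R, KummerCore.toGeomPoints_mem_fixedGeomPoints W ⊤ R⟩) =
      ((W.baseChange K).baseChange (𝔭.adicCompletion K)).kummerFamily p
        (localSubgroupOfEmb ⊤ (closureEmb (K := K) (𝔭.adicCompletion K)))
        ⟨toGeomPoints ((W.baseChange K).baseChange (𝔭.adicCompletion K)) (bc R),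
          KummerCore.toGeomPoints_mem_fixedGeomPoints (W.baseChange K) _ (bc R)⟩ := by
    intro R
    have hfix : ∀ σ ∈ (⊤ : Subgroup (absoluteGaloisGroup K)),
        σ • toGeomPoints (W.baseChange K) R = toGeomPoints (W.baseChange K) R :=
      ((W.baseChange K).mem_fixedGeomPoints_iff _).1 (KummerCore.toGeomPoints_mem_fixedGeomPoints W ⊤ R)
    rw [IsKummerFamilyOver.eq_kummerFamily p
      ((W.baseChange K).smul_geomPointsMapOfEmb_of_fixed (closureEmb (K := K) (𝔭.adicCompletion K)) ⊤ hfix)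
      (IsKummerFamilyOver.localTorsionResPi (W.baseChange K) (closureEmb (K := K) (𝔭.adicCompletion K))
        p ⊤ hfix ((W.baseChange K).isKummerFamilyOver_kummerFamily p ⊤
          ⟨toGeomPoints (W.baseChange K) R, KummerCore.toGeomPoints_mem_fixedGeomPoints W ⊤ R⟩))]
    congr 1
    exact Subtype.ext (KummerCore.geomPointsMapOfEmb_toGeomPoints (W.baseChange K) _ R)
  have h0 := congrArg
    ((W.baseChange K).localTorsionResPi (closureEmb (K := K) (𝔭.adicCompletion K)) p ⊤) h
  rw [map_add, localTorsionResPi_padicPi, localTorsionResPi_padicPi, hlocfam PK, hlocfam T₂, map_zero]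
    at h0
  have hαβ := hdet (bc PK) (bc T₂) α β h0
  have e1 : Φ (bc PK) = (lam (W.toPadicPoint p P), 0) := hV1 P
  have e2 : Φ (bc T₂) = (0, lam' (W'.toPadicPoint p P')) := hT₂
  rw [e1, e2, Prod.smul_mk, Prod.smul_mk, Prod.mk_add_mk, Prod.mk_eq_zero, smul_zero, smul_zero,
    add_zero, zero_add, smul_eq_mul, smul_eq_mul] at hαβ
  exact ⟨(mul_eq_zero.1 hαβ.1).resolve_right hx₁, (mul_eq_zero.1 hαβ.2).resolve_right hx₂⟩

/-- **At an O11 frame, a bottom index exponent forces `S_{p,rel}(E/K) = S_p(E/K)`**: with non-torsion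
`P ∈ W(ℚ)`, `P' ∈ W'(ℚ)` (the frame data of the crux), any `ℤ_p`-tower `κ` of `K`, and any family `z`
with `[S_rel : tors ⊔ 𝒪_𝔭 · z] = p^c` at the bottom layer — `relaxed_eq_compact_of_rank` fed with the two
independent Kummer families of `exists_independent_kummerFamilies_of_frame` (both in `S_p(E/K)`,
`KummerFamiliesSelmer.mem_compactSelmerOver_of_isKummerFamilyOver`, p464144).
[cite: BurungaleKobayashiNakamuraOta2026, §3.1.2 and §3.3.1 (arXiv:2608.06879 pp. 16, 19) (shape only)]
[cite: SilvermanAEC2009, Cor. III.9.4 and Exercise 10.16] -/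
theorem relaxed_eq_compact_of_frame (hF : X12.O11.IsFrame W p K 𝔭 W' C)
    {P : W.toAffine.Point} (hP : ¬ IsOfFinAddOrder P) {P' : W'.toAffine.Point}
    (hP' : ¬ IsOfFinAddOrder P') (κ : ZpExtension K p) (Pl : Set (HeightOneSpectrum (𝓞 K)))
    {z : (W.baseChange K).torsionH1Pi p (κ.layerSubgroup 0)} {c : ℕ}
    (hc : (AddCommGroup.torsion ((W.baseChange K).torsionH1Pi p (κ.layerSubgroup 0)) ⊔
        (W.baseChange K).padicEndSpan p (κ.layerSubgroup 0) z).relIndex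
      ((W.baseChange K).relaxedCompactSelmerOver (κ.layerSubgroup 0) p Pl) = p ^ c) :
    (W.baseChange K).relaxedCompactSelmerOver (κ.layerSubgroup 0) p Pl =
      (W.baseChange K).compactSelmerOver (κ.layerSubgroup 0) p := by
  haveI : (W.baseChange K).IsElliptic := inferInstanceAs (W.map (algebraMap ℚ K)).IsElliptic
  obtain ⟨m₁, m₂, hind⟩ := exists_independent_kummerFamilies_of_frame W p hF hP hP'
    (κ.layerSubgroup 0) (ZpExtension.layerSubgroup_zero κ)
  exact relaxed_eq_compact_of_rank (W.baseChange K) p κ Pl hc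
    (KummerFamiliesSelmer.mem_compactSelmerOver_of_isKummerFamilyOver (W.baseChange K) p κ _
      ((W.baseChange K).isKummerFamilyOver_kummerFamily p (κ.layerSubgroup 0) m₁))
    (KummerFamiliesSelmer.mem_compactSelmerOver_of_isKummerFamilyOver (W.baseChange K) p κ _
      ((W.baseChange K).isKummerFamilyOver_kummerFamily p (κ.layerSubgroup 0) m₂))
    hind

/-- **Hence (sat) from (S_sat-MW) at an O11 frame**: `[S_rel : tors ⊔ 𝒪_𝔭 · z] = p^c`, non-torsion
`P`, `P'`, and `S_p(E/K) ≤ E(K) ⊗ ℤ_p` give `S_{p,rel}(E/K) ≤ E(K) ⊗ ℤ_p`.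
[cite: PerrinRiou1987BSMF, §0 pp. 401–402 (`0 → E(L) ⊗ ℤ_p → S_p(L) → T_pШ → 0`)] -/
theorem relaxed_le_mordellWeilKummerSpan_of_frame (hF : X12.O11.IsFrame W p K 𝔭 W' C)
    {P : W.toAffine.Point} (hP : ¬ IsOfFinAddOrder P) {P' : W'.toAffine.Point}
    (hP' : ¬ IsOfFinAddOrder P') (κ : ZpExtension K p) (Pl : Set (HeightOneSpectrum (𝓞 K)))
    {z : (W.baseChange K).torsionH1Pi p (κ.layerSubgroup 0)} {c : ℕ}
    (hc : (AddCommGroup.torsion ((W.baseChange K).torsionH1Pi p (κ.layerSubgroup 0)) ⊔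
        (W.baseChange K).padicEndSpan p (κ.layerSubgroup 0) z).relIndex
      ((W.baseChange K).relaxedCompactSelmerOver (κ.layerSubgroup 0) p Pl) = p ^ c)
    (hMW : (W.baseChange K).compactSelmerOver (κ.layerSubgroup 0) p ≤
      (W.baseChange K).mordellWeilKummerSpan p (κ.layerSubgroup 0)) :
    (W.baseChange K).relaxedCompactSelmerOver (κ.layerSubgroup 0) p Pl ≤
      (W.baseChange K).mordellWeilKummerSpan p (κ.layerSubgroup 0) := by
  rw [relaxed_eq_compact_of_frame W p hF hP hP' κ Pl hc]
  exact hMW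

/-- **The datum form (S_sat(alt), rank route): `hcZp → (S_p(E/K) ≤ E(K) ⊗ ℤ_p) → S_{p,rel}(E/K) ≤
E(K) ⊗ ℤ_p`** at an O11 frame with non-torsion `P`, `P'`, for EVERY anticyclotomic elliptic-unit class
datum `D` with a bottom index exponent (`D.HasBottomIndexExpZp c`) — no `hvan`, no explicit reciprocity,
no duality. Supersedes `RelaxedEqCompact.relaxed_le_mordellWeilKummerSpan_of_hasBottomIndexExpZp_of_hvan`
(p472558). [cite: BurungaleKobayashiNakamuraOta2026, §3.1.2, §3.3.1 and Lemma 7.1 (arXiv:2608.06879 pp. 16, 19, 40) (claim; preprint; shape only)]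
[cite: PerrinRiou1987BSMF, §0 pp. 401–402] -/
theorem relaxed_le_mordellWeilKummerSpan_of_hasBottomIndexExpZp_of_frame
    (hF : X12.O11.IsFrame W p K 𝔭 W' C)
    {P : W.toAffine.Point} (hP : ¬ IsOfFinAddOrder P) {P' : W'.toAffine.Point}
    (hP' : ¬ IsOfFinAddOrder P') {κ : ZpExtension K p} {γ : absoluteGaloisGroup K}
    {ι : PadicAlgCl p ≃+* ℂ} {φ : HeckeCharacter K} {Ω : ℂ} {𝓔 : AcDualExpSystem W p K 𝔭 κ ι}
    (D : EllipticUnitClassData W p K 𝔭 κ γ ι φ Ω 𝓔) {c : ℕ} (hc : D.HasBottomIndexExpZp c)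
    (hMW : (W.baseChange K).compactSelmerOver (κ.layerSubgroup 0) p ≤
      (W.baseChange K).mordellWeilKummerSpan p (κ.layerSubgroup 0)) :
    (W.baseChange K).relaxedCompactSelmerOver (κ.layerSubgroup 0) p {𝔭} ≤
      (W.baseChange K).mordellWeilKummerSpan p (κ.layerSubgroup 0) :=
  relaxed_le_mordellWeilKummerSpan_of_frame W p hF hP hP' κ {𝔭} hc hMW

end Frame

end RelaxedEqCompactRank

end Summit.BirchSwinnertonDyer.BirchSwinnertonDyer.Theorems.RamifiedSevenEllipticUnits

end
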